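import Summits.CriticalPhenomena.PercolationContinuityZ3.Theorems.PercNearOneGluingNoHeavyLowerTailSahiH4PlusOrThree
import Summits.CriticalPhenomena.PercolationContinuityZ3.Theorems.PercNearOneGluingNoHeavyLowerTailSahiE4UnionTensorMoments
import Literature.Combinatorics.Sahi2008.ProductOfChains
import Summits.CriticalPhenomena.PercolationContinuityZ3.Theorems.PercNearOneGluingNoHeavyLowerTailSahiC3CubeFourFKGLattices
import Mathlib.Data.Fin.Tuple.Basic
import Mathlib.Algebra.BigOperators.Fin
import Mathlib.Data.Fintype.BigOperators
import Mathlib.Tactic.FinCases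
import HarnessLib

/-!
# `NoHeavyLowerTail` (crux stmt-CriticalPhenomena-4575), Sahi programme P4 — ★ READ-ONCE UNIONS: `H₄⁺` (in particular `E₄ ≥ 0`) for the
# member-wise OR of any number of independent Sahi-3-positive monotone blocks, each feeding at most three of the four members

Support file (cell `prim-l12`, seat P4, generation 38; `--supports stmt-CriticalPhenomena-4575`).  No definitions, no named facts, no sorries;
standard axioms.

SETTING. `β` a finite preorder; `r` blocks: probability weights `ν_k` on `β`, each Sahi-positive of order 3, and monotone `[0,1]`-valued
`b_k : Fin 4 → β → [0,1]` with an unfed member `m_k` (`b_k (m_k) = 0`), `k < r`.  On the product space `Ω = (Fin r → β)` with the product weight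
`W(ω) = Π_k ν_k(ω_k)` (independent blocks) the READ-ONCE UNION is `u_i(ω) = 1 − Π_k (1 − b_k i (ω_k))` (`= ⋁_k b_k i` for events).
THEOREM `h4Plus_readOnce`: `H4Plus W u` — Sahi's `E₃ ≥ 0` on the four sub-triples of `u`, the six order-3 product rows and `E₄(u) ≥ 0` —
together with `SahiPositive W 2` and `∑ W = 1`.  PROOF: induction on `r`; the step is `h4Plus_orBlock` (`…SahiH4PlusOrThree`: the `|K| ≤ 3` rungs
of generations 32–38) on `(Fin r → β) × β`, transported along `Fin.cons` (an order isomorphism `β × (Fin r → β) ≃ (Fin (r+1) → β)`); positive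
association of the product weight is `SahiPAProduct.sahiPositive_two_prodWeight`.  COROLLARY `sahiE_four_readOnce_nonneg`: `E₄^{W}(u) ≥ 0`.
HONEST FRAMING: every block must miss at least one member — a block feeding all four members is the open `|K| = 4` step of the closure
programme; nothing here is Sahi's conjecture `C₄` itself (the hypothesis `SahiPositive ν_k 3` is Sahi's `C₃` for the block's lattice, known e.g.
for products of two chains [LiebSahi2021, Thm. 3.7] and for distributive lattices with ≤ 4… see the tree's `SahiCubeAllOrders`). [this work]
-/

noncomputable section

namespace Summit.CriticalPhenomena.PercolationContinuityZ3.Theorems.SahiH4Plus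

open Finset Function Literature.Combinatorics.Sahi2008
open Summit.CriticalPhenomena.PercolationContinuityZ3.Theorems.SahiE4UnionTensor (sahiE_four_apply)
open Summit.CriticalPhenomena.PercolationContinuityZ3.Theorems.SahiPAProduct (sahiPositive_two_prodWeight)

/-! ### Transport along a bijection of the base space -/
section transport
variable {γ δ : Type*} [Fintype γ] [Fintype δ]

/-- Change of variables for `E` along a bijection. [folklore] -/
theorem ex_comp_equiv (e : γ ≃ δ) (μ : δ → ℝ) (f : δ → ℝ) : ex (μ ∘ e) (f ∘ e) = ex μ f := by
  simp only [ex_def, Function.comp]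
  exact Fintype.sum_equiv e _ _ fun x => rfl

/-- Change of variables for `E₂`. [folklore] -/
theorem sahiE_two_comp_equiv (e : γ ≃ δ) (μ : δ → ℝ) (f : Fin 2 → δ → ℝ) :
    sahiE (μ ∘ e) 2 (fun i => f i ∘ e) = sahiE μ 2 f := by
  simp only [sahiE_two_apply, ← Pi.mul_comp, ex_comp_equiv]

/-- Change of variables for `E₃`. [folklore] -/
theorem sahiE_three_comp_equiv (e : γ ≃ δ) (μ : δ → ℝ) (f g h : δ → ℝ) :
    sahiE (μ ∘ e) 3 ![f ∘ e, g ∘ e, h ∘ e] = sahiE μ 3 ![f, g, h] := by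
  simp only [sahiE_three, ← Pi.mul_comp, ex_comp_equiv]

/-- Change of variables for `E₄`. [folklore] -/
theorem sahiE_four_comp_equiv (e : γ ≃ δ) (μ : δ → ℝ) (a : Fin 4 → δ → ℝ) :
    sahiE (μ ∘ e) 4 (fun i => a i ∘ e) = sahiE μ 4 a := by
  simp only [sahiE_four_apply, ← Pi.mul_comp, ex_comp_equiv]

/-- `H₄⁺` is transported along a bijection of the base space. [this work] -/
theorem h4Plus_comp_equiv (e : γ ≃ δ) {μ : δ → ℝ} {a : Fin 4 → δ → ℝ} (h : H4Plus μ a) :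
    H4Plus (μ ∘ e) (fun i => a i ∘ e) := by
  have t3 : ∀ (F G K : δ → ℝ), 0 ≤ sahiE μ 3 ![F, G, K] → 0 ≤ sahiE (μ ∘ e) 3 ![F ∘ e, G ∘ e, K ∘ e] :=
    fun F G K hh => by rw [sahiE_three_comp_equiv]; exact hh
  refine ⟨?_, ?_, ?_, ?_, ?_, ?_, ?_, ?_, ?_, ?_, ?_⟩
  · exact t3 _ _ _ h.e3_012
  · exact t3 _ _ _ h.e3_013
  · exact t3 _ _ _ h.e3_023
  · exact t3 _ _ _ h.e3_123
  · show 0 ≤ sahiE (μ ∘ e) 3 ![(a 0 ∘ e) * (a 1 ∘ e), a 2 ∘ e, a 3 ∘ e]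
    rw [← Pi.mul_comp]; exact t3 (a 0 * a 1) _ _ h.p3_01
  · show 0 ≤ sahiE (μ ∘ e) 3 ![(a 0 ∘ e) * (a 2 ∘ e), a 1 ∘ e, a 3 ∘ e]
    rw [← Pi.mul_comp]; exact t3 (a 0 * a 2) _ _ h.p3_02
  · show 0 ≤ sahiE (μ ∘ e) 3 ![(a 1 ∘ e) * (a 2 ∘ e), a 0 ∘ e, a 3 ∘ e]
    rw [← Pi.mul_comp]; exact t3 (a 1 * a 2) _ _ h.p3_12
  · show 0 ≤ sahiE (μ ∘ e) 3 ![(a 0 ∘ e) * (a 3 ∘ e), a 1 ∘ e, a 2 ∘ e]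
    rw [← Pi.mul_comp]; exact t3 (a 0 * a 3) _ _ h.p3_03
  · show 0 ≤ sahiE (μ ∘ e) 3 ![(a 1 ∘ e) * (a 3 ∘ e), a 0 ∘ e, a 2 ∘ e]
    rw [← Pi.mul_comp]; exact t3 (a 1 * a 3) _ _ h.p3_13
  · show 0 ≤ sahiE (μ ∘ e) 3 ![(a 2 ∘ e) * (a 3 ∘ e), a 0 ∘ e, a 1 ∘ e]
    rw [← Pi.mul_comp]; exact t3 (a 2 * a 3) _ _ h.p3_23
  · show 0 ≤ sahiE (μ ∘ e) 4 (fun i => a i ∘ e)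
    rw [sahiE_four_comp_equiv]; exact h.e4

/-- Positive association is transported along an order isomorphism of the base space. [folklore] -/
theorem sahiPositive_two_comp_equiv [Preorder γ] [Preorder δ] (e : γ ≃ δ) (he : ∀ x y : δ, x ≤ y → e.symm x ≤ e.symm y)
    {μ : δ → ℝ} (h : SahiPositive μ 2) : SahiPositive (μ ∘ e) 2 := by
  intro f hf hfm
  have key : sahiE (μ ∘ e) 2 f = sahiE μ 2 (fun i => f i ∘ e.symm) := by
    have t := sahiE_two_comp_equiv e μ (fun i => f i ∘ e.symm)
    have hf' : (fun i => (f i ∘ e.symm) ∘ e) = f := by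
      funext i x; simp only [Function.comp, Equiv.symm_apply_apply]
    rw [hf'] at t
    exact t
  rw [key]
  exact h _ (fun i y => hf i _) (fun i y y' hyy => hfm i (he y y' hyy))

end transport

/-! ### Read-once unions of independent blocks -/
section readOnce
variable {β : Type*} [Fintype β] [Preorder β]

/-- `H₄⁺` of the zero family (all functionals vanish). [folklore] -/
theorem h4Plus_zero {γ : Type*} [Fintype γ] (μ : γ → ℝ) : H4Plus μ (fun (_ : Fin 4) (_ : γ) => (0:ℝ)) := by
  refine ⟨?_, ?_, ?_, ?_, ?_, ?_, ?_, ?_, ?_, ?_, ?_⟩ <;>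
    simp [sahiE_three, sahiE_four_apply, ex_def]

omit [Fintype β] [Preorder β] in
/-- The read-once union is `[0,1]`-valued. [folklore] -/
theorem readOnce_mem_unitInterval {r : ℕ} (b : Fin r → Fin 4 → β → ℝ) (hb0 : ∀ k i t, 0 ≤ b k i t) (hb1 : ∀ k i t, b k i t ≤ 1)
    (i : Fin 4) (ω : Fin r → β) : 0 ≤ 1 - ∏ k, (1 - b k i (ω k)) ∧ 1 - ∏ k, (1 - b k i (ω k)) ≤ 1 := by
  have h0 : 0 ≤ ∏ k, (1 - b k i (ω k)) := Finset.prod_nonneg fun k _ => sub_nonneg.2 (hb1 k i _)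
  have h1 : ∏ k, (1 - b k i (ω k)) ≤ 1 := Finset.prod_le_one (fun k _ => sub_nonneg.2 (hb1 k i _)) fun k _ => by linarith [hb0 k i (ω k)]
  constructor <;> linarith

omit [Fintype β] in
/-- The read-once union is monotone (componentwise order on `Fin r → β`). [folklore] -/
theorem readOnce_monotone {r : ℕ} (b : Fin r → Fin 4 → β → ℝ) (hb1 : ∀ k i t, b k i t ≤ 1)
    (hbm : ∀ k i, Monotone (b k i)) (i : Fin 4) : Monotone (fun ω : Fin r → β => 1 - ∏ k, (1 - b k i (ω k))) := by
  intro ω ω' hle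
  have h : ∏ k, (1 - b k i (ω' k)) ≤ ∏ k, (1 - b k i (ω k)) :=
    Finset.prod_le_prod (fun k _ => sub_nonneg.2 (hb1 k i _)) fun k _ => sub_le_sub_left (hbm k i (hle k)) 1
  simp only [sub_le_sub_iff_left]
  exact h

/-- **Read-once unions**, inductive form: total mass `1`, positive association of the product weight, and `H₄⁺` of the union. [this work] -/
theorem h4Plus_readOnce_aux (r : ℕ) (ν : Fin r → β → ℝ) (hν0 : ∀ k t, 0 ≤ ν k t) (hν1 : ∀ k, ∑ t, ν k t = 1)
    (hν3 : ∀ k, SahiPositive (ν k) 3) (b : Fin r → Fin 4 → β → ℝ) (hb0 : ∀ k i t, 0 ≤ b k i t) (hb1 : ∀ k i t, b k i t ≤ 1)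
    (hbm : ∀ k i, Monotone (b k i)) (m : Fin r → Fin 4) (hbz : ∀ k t, b k (m k) t = 0) :
    (∑ ω : Fin r → β, ∏ k, ν k (ω k)) = 1 ∧ SahiPositive (fun ω : Fin r → β => ∏ k, ν k (ω k)) 2 ∧
      H4Plus (fun ω : Fin r → β => ∏ k, ν k (ω k)) (fun (i : Fin 4) (ω : Fin r → β) => 1 - ∏ k, (1 - b k i (ω k))) := by
  induction r with
  | zero =>
    refine ⟨?_, ?_, ?_⟩
    · simp
    · intro f _ _
      rw [sahiE_two_apply]
      simp [ex_def]
    · have hz : (fun (i : Fin 4) (ω : Fin 0 → β) => 1 - ∏ k, (1 - b k i (ω k))) = fun _ _ => (0:ℝ) := by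
        funext i ω; simp
      rw [hz]; exact h4Plus_zero _
  | succ r ih =>
    -- the first `r` blocks after dropping block `0`
    obtain ⟨S1, PA, H⟩ := ih (fun k => ν k.succ) (fun k t => hν0 _ t) (fun k => hν1 _) (fun k => hν3 _)
      (fun k => b k.succ) (fun k i t => hb0 _ i t) (fun k i t => hb1 _ i t) (fun k i => hbm _ i) (fun k => m k.succ) (fun k t => hbz _ t)
    set W' : (Fin r → β) → ℝ := fun ω => ∏ k, ν k.succ (ω k) with hW'
    set U' : Fin 4 → (Fin r → β) → ℝ := fun i ω => 1 - ∏ k, (1 - b k.succ i (ω k)) with hU'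
    have hW'0 : ∀ ω, 0 ≤ W' ω := fun ω => Finset.prod_nonneg fun k _ => hν0 _ _
    have hU'0 : ∀ i ω, 0 ≤ U' i ω := fun i ω => (readOnce_mem_unitInterval (fun k => b k.succ) (fun k => hb0 _) (fun k => hb1 _) i ω).1
    have hU'1 : ∀ i ω, U' i ω ≤ 1 := fun i ω => (readOnce_mem_unitInterval (fun k => b k.succ) (fun k => hb0 _) (fun k => hb1 _) i ω).2
    have hU'm : ∀ i, Monotone (U' i) := fun i => readOnce_monotone (fun k => b k.succ) (fun k => hb1 _) (fun k => hbm _) i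
    -- one OR step on `(Fin r → β) × β` with the block `0`
    have step := h4Plus_orBlock (m 0) W' (ν 0) hW'0 S1 (hν0 0) (hν1 0) PA (hν3 0) U' (b 0) hU'0 hU'1 hU'm
      (hb0 0) (hb1 0) (hbm 0) (hbz 0) H
    have hν2 : SahiPositive (ν 0) 2 := SahiPositive.of_succ (hν0 0) (hν1 0) (hν3 0)
    have paV : SahiPositive (fun p : (Fin r → β) × β => W' p.1 * ν 0 p.2) 2 := sahiPositive_two_prodWeight W' (ν 0) hW'0 (hν0 0) PA hν2
    -- the order isomorphism `(Fin r → β) × β ≃ (Fin (r+1) → β)`, `(ω', y) ↦ Fin.cons y ω'`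
    let E : ((Fin r → β) × β) ≃ (Fin (r + 1) → β) :=
      ⟨fun p => Fin.cons p.2 p.1, fun ω => (Fin.tail ω, ω 0),
       fun p => by simp only [Fin.tail_cons, Fin.cons_zero],
       fun ω => by simp only [Fin.cons_self_tail]⟩
    have hEs : ∀ ω : Fin (r + 1) → β, E.symm ω = (Fin.tail ω, ω 0) := fun ω => rfl
    have hmono : ∀ x y : (Fin r → β) × β, x ≤ y → E.symm.symm x ≤ E.symm.symm y := by
      intro x y hxy
      show (Fin.cons x.2 x.1 : Fin (r + 1) → β) ≤ Fin.cons y.2 y.1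
      exact Fin.cons_le_cons.2 ⟨hxy.2, hxy.1⟩
    -- identify the transported weight and family
    have hW : ((fun p : (Fin r → β) × β => W' p.1 * ν 0 p.2) ∘ E.symm) = fun ω : Fin (r + 1) → β => ∏ k, ν k (ω k) := by
      funext ω
      simp only [Function.comp, hEs, hW']
      rw [Fin.prod_univ_succ]
      simp only [Fin.tail]
      ring
    have hU : (fun i => (fun (i : Fin 4) (p : (Fin r → β) × β) => U' i p.1 + b 0 i p.2 - U' i p.1 * b 0 i p.2) i ∘ E.symm)
        = fun (i : Fin 4) (ω : Fin (r + 1) → β) => 1 - ∏ k, (1 - b k i (ω k)) := by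
      funext i ω
      simp only [Function.comp, hEs, hU']
      rw [Fin.prod_univ_succ]
      simp only [Fin.tail]
      ring
    refine ⟨?_, ?_, ?_⟩
    · -- total mass
      have hVW : ∀ p : (Fin r → β) × β, W' p.1 * ν 0 p.2 = ∏ k, ν k ((E p) k) := by
        intro p
        have := congrArg (fun F => F (E p)) hW
        simp only [Function.comp, Equiv.symm_apply_apply] at this
        exact this
      rw [← Fintype.sum_equiv E _ _ hVW, Fintype.sum_prod_type]
      simp only [← Finset.mul_sum, hν1 0, mul_one]
      exact S1
    · have t := sahiPositive_two_comp_equiv E.symm hmono paV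
      rw [hW] at t; exact t
    · have t := h4Plus_comp_equiv E.symm step
      rw [hW, hU] at t; exact t

/-- **★ READ-ONCE UNIONS satisfy `H₄⁺`.**  For `r` independent blocks on a finite preorder `β` — probability weights `ν_k`, each Sahi-positive of
order 3, and monotone `[0,1]`-valued `b_k : Fin 4 → β → [0,1]` each missing at least one member (`b_k (m_k) = 0`) — the member-wise OR
`u_i(ω) = 1 − Π_k (1 − b_k i (ω_k))` on `Ω = (Fin r → β)` with the product weight satisfies `H₄⁺`: `E₃ ≥ 0` on the four sub-triples, the six
order-3 product rows, and `E₄(u) ≥ 0`. [this work] -/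
theorem h4Plus_readOnce (r : ℕ) (ν : Fin r → β → ℝ) (hν0 : ∀ k t, 0 ≤ ν k t) (hν1 : ∀ k, ∑ t, ν k t = 1)
    (hν3 : ∀ k, SahiPositive (ν k) 3) (b : Fin r → Fin 4 → β → ℝ) (hb0 : ∀ k i t, 0 ≤ b k i t) (hb1 : ∀ k i t, b k i t ≤ 1)
    (hbm : ∀ k i, Monotone (b k i)) (m : Fin r → Fin 4) (hbz : ∀ k t, b k (m k) t = 0) :
    H4Plus (fun ω : Fin r → β => ∏ k, ν k (ω k)) (fun (i : Fin 4) (ω : Fin r → β) => 1 - ∏ k, (1 - b k i (ω k))) :=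
  (h4Plus_readOnce_aux r ν hν0 hν1 hν3 b hb0 hb1 hbm m hbz).2.2

/-- **`E₄ ≥ 0` for read-once unions** of independent Sahi-3-positive monotone blocks each feeding at most three members. [this work] -/
theorem sahiE_four_readOnce_nonneg (r : ℕ) (ν : Fin r → β → ℝ) (hν0 : ∀ k t, 0 ≤ ν k t) (hν1 : ∀ k, ∑ t, ν k t = 1)
    (hν3 : ∀ k, SahiPositive (ν k) 3) (b : Fin r → Fin 4 → β → ℝ) (hb0 : ∀ k i t, 0 ≤ b k i t) (hb1 : ∀ k i t, b k i t ≤ 1)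
    (hbm : ∀ k i, Monotone (b k i)) (m : Fin r → Fin 4) (hbz : ∀ k t, b k (m k) t = 0) :
    0 ≤ sahiE (fun ω : Fin r → β => ∏ k, ν k (ω k)) 4 (fun (i : Fin 4) (ω : Fin r → β) => 1 - ∏ k, (1 - b k i (ω k))) :=
  (h4Plus_readOnce r ν hν0 hν1 hν3 b hb0 hb1 hbm m hbz).e4


/-- **Unconditional instance: blocks on products of two finite chains.**  For `r` independent blocks, block `k` living on the grid
`Fin (p+1) × Fin (q+1)` (componentwise order) with an arbitrary PRODUCT probability weight `w₁ᵏ ⊗ w₂ᵏ` (Sahi-positive of every order by the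
discrete Lieb–Sahi Theorem 3.7, `ProductChains.sahiPositive_prodWeight`) and monotone `[0,1]`-valued members `b_k i` each block missing at
least one member, the read-once union has `E₄ ≥ 0` — no unproved hypothesis. [this work] (uses [LiebSahi2021, Thm. 3.7]) -/
theorem sahiE_four_readOnce_biChain_nonneg (p q r : ℕ) (w₁ : Fin r → Fin (p + 1) → ℝ) (w₂ : Fin r → Fin (q + 1) → ℝ)
    (h₁0 : ∀ k i, 0 ≤ w₁ k i) (h₁1 : ∀ k, ∑ i, w₁ k i = 1) (h₂0 : ∀ k j, 0 ≤ w₂ k j) (h₂1 : ∀ k, ∑ j, w₂ k j = 1)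
    (b : Fin r → Fin 4 → (Fin (p + 1) × Fin (q + 1)) → ℝ) (hb0 : ∀ k i t, 0 ≤ b k i t) (hb1 : ∀ k i t, b k i t ≤ 1)
    (hbm : ∀ k i, Monotone (b k i)) (m : Fin r → Fin 4) (hbz : ∀ k t, b k (m k) t = 0) :
    0 ≤ sahiE (fun ω : Fin r → Fin (p + 1) × Fin (q + 1) => ∏ k, (w₁ k (ω k).1 * w₂ k (ω k).2)) 4
      (fun (i : Fin 4) (ω : Fin r → Fin (p + 1) × Fin (q + 1)) => 1 - ∏ k, (1 - b k i (ω k))) := by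
  set ν : Fin r → (Fin (p + 1) × Fin (q + 1)) → ℝ := fun k t => w₁ k t.1 * w₂ k t.2 with hν
  have hν0 : ∀ k t, 0 ≤ ν k t := fun k t => mul_nonneg (h₁0 k _) (h₂0 k _)
  have hν1 : ∀ k, ∑ t, ν k t = 1 := by
    intro k
    simp only [hν]
    rw [Fintype.sum_prod_type, ← Finset.sum_mul_sum, h₁1 k, h₂1 k, one_mul]
  have hν3 : ∀ k, SahiPositive (ν k) 3 := fun k =>
    ProductChains.sahiPositive_prodWeight (w₁ k) (w₂ k) (h₁0 k) (h₁1 k) (h₂0 k) (h₂1 k) 3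
  have key := sahiE_four_readOnce_nonneg r ν hν0 hν1 hν3 b hb0 hb1 hbm m hbz
  have hW : (fun ω : Fin r → Fin (p + 1) × Fin (q + 1) => ∏ k, (w₁ k (ω k).1 * w₂ k (ω k).2))
      = fun ω => ∏ k, ν k (ω k) := by funext ω; simp only [hν]
  rw [hW]
  exact key

/-- **Unconditional instance: FKG blocks on distributive lattices with at most four join-irreducibles** (e.g. the cube `{0,1}⁴` with any
log-supermodular probability weight, in particular any product measure on four bits).  For `r` independent such blocks with monotone
`[0,1]`-valued members, each block missing at least one member, the read-once union has `E₄ ≥ 0`.  Sahi positivity of order 3 of the blocks is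
the tree's `SahiC3CubeFourFKG.sahiPositive_three_of_card_supIrred_le_four` (Sahi's `C₃` on `2⁴`, kernel-checked). [this work] -/
theorem sahiE_four_readOnce_fkgFour_nonneg {α : Type*} [DistribLattice α] [Fintype α] [DecidableEq α]
    (h4 : Nat.card {j : α // SupIrred j} ≤ 4) (r : ℕ) (ν : Fin r → α → ℝ) (hν : ∀ k, IsFKGMeasure (ν k))
    (b : Fin r → Fin 4 → α → ℝ) (hb0 : ∀ k i t, 0 ≤ b k i t) (hb1 : ∀ k i t, b k i t ≤ 1)
    (hbm : ∀ k i, Monotone (b k i)) (m : Fin r → Fin 4) (hbz : ∀ k t, b k (m k) t = 0) :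
    0 ≤ sahiE (fun ω : Fin r → α => ∏ k, ν k (ω k)) 4 (fun (i : Fin 4) (ω : Fin r → α) => 1 - ∏ k, (1 - b k i (ω k))) :=
  sahiE_four_readOnce_nonneg r ν (fun k t => (hν k).nonneg t) (fun k => (hν k).sum_eq_one)
    (fun k => SahiC3CubeFourFKG.sahiPositive_three_of_card_supIrred_le_four h4 (hν k)) b hb0 hb1 hbm m hbz

/-! ### Order 3: read-once unions with NO missing-member condition -/

/-- Change of variables for `E₃` of an arbitrary `Fin 3`-family. [folklore] -/
theorem sahiE_three_comp_equiv' {γ δ : Type*} [Fintype γ] [Fintype δ] (e : γ ≃ δ) (μ : δ → ℝ) (f : Fin 3 → δ → ℝ) :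
    sahiE (μ ∘ e) 3 (fun i => f i ∘ e) = sahiE μ 3 f := by
  simp only [sahiE_three_apply, ← Pi.mul_comp, ex_comp_equiv]

omit [Fintype β] [Preorder β] in
/-- The read-once union of `n`-member blocks is `[0,1]`-valued. [folklore] -/
theorem readOnce_mem_unitInterval' {r n : ℕ} (b : Fin r → Fin n → β → ℝ) (hb0 : ∀ k i t, 0 ≤ b k i t) (hb1 : ∀ k i t, b k i t ≤ 1)
    (i : Fin n) (ω : Fin r → β) : 0 ≤ 1 - ∏ k, (1 - b k i (ω k)) ∧ 1 - ∏ k, (1 - b k i (ω k)) ≤ 1 := by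
  have h0 : 0 ≤ ∏ k, (1 - b k i (ω k)) := Finset.prod_nonneg fun k _ => sub_nonneg.2 (hb1 k i _)
  have h1 : ∏ k, (1 - b k i (ω k)) ≤ 1 := Finset.prod_le_one (fun k _ => sub_nonneg.2 (hb1 k i _)) fun k _ => by linarith [hb0 k i (ω k)]
  constructor <;> linarith

omit [Fintype β] in
/-- The read-once union of `n`-member blocks is monotone. [folklore] -/
theorem readOnce_monotone' {r n : ℕ} (b : Fin r → Fin n → β → ℝ) (hb1 : ∀ k i t, b k i t ≤ 1)
    (hbm : ∀ k i, Monotone (b k i)) (i : Fin n) : Monotone (fun ω : Fin r → β => 1 - ∏ k, (1 - b k i (ω k))) := by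
  intro ω ω' hle
  have h : ∏ k, (1 - b k i (ω' k)) ≤ ∏ k, (1 - b k i (ω k)) :=
    Finset.prod_le_prod (fun k _ => sub_nonneg.2 (hb1 k i _)) fun k _ => sub_le_sub_left (hbm k i (hle k)) 1
  simp only [sub_le_sub_iff_left]
  exact h

/-- **Read-once unions at ORDER 3**, inductive form: for `r` independent Sahi-3-positive monotone `[0,1]`-valued blocks of THREE members
(no missing-member condition), total mass `1`, positive association of the product weight and `E₃(u) ≥ 0` for the member-wise OR. The
step is the tree's `SahiE3UnionTensor.sahiE_three_por_nonneg_of_sahiPositive_two` (generation 32). [this work] -/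
theorem sahiE_three_readOnce_aux (r : ℕ) (ν : Fin r → β → ℝ) (hν0 : ∀ k t, 0 ≤ ν k t) (hν1 : ∀ k, ∑ t, ν k t = 1)
    (hν3 : ∀ k, SahiPositive (ν k) 3) (b : Fin r → Fin 3 → β → ℝ) (hb0 : ∀ k i t, 0 ≤ b k i t) (hb1 : ∀ k i t, b k i t ≤ 1)
    (hbm : ∀ k i, Monotone (b k i)) :
    (∑ ω : Fin r → β, ∏ k, ν k (ω k)) = 1 ∧ SahiPositive (fun ω : Fin r → β => ∏ k, ν k (ω k)) 2 ∧
      0 ≤ sahiE (fun ω : Fin r → β => ∏ k, ν k (ω k)) 3 (fun (i : Fin 3) (ω : Fin r → β) => 1 - ∏ k, (1 - b k i (ω k))) := by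
  induction r with
  | zero =>
    refine ⟨?_, ?_, ?_⟩
    · simp
    · intro f _ _
      rw [sahiE_two_apply]
      simp [ex_def]
    · simp [sahiE_three_apply, ex_def]
  | succ r ih =>
    obtain ⟨S1, PA, H⟩ := ih (fun k => ν k.succ) (fun k t => hν0 _ t) (fun k => hν1 _) (fun k => hν3 _)
      (fun k => b k.succ) (fun k i t => hb0 _ i t) (fun k i t => hb1 _ i t) (fun k i => hbm _ i)
    set W' : (Fin r → β) → ℝ := fun ω => ∏ k, ν k.succ (ω k) with hW'
    set U' : Fin 3 → (Fin r → β) → ℝ := fun i ω => 1 - ∏ k, (1 - b k.succ i (ω k)) with hU'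
    have hW'0 : ∀ ω, 0 ≤ W' ω := fun ω => Finset.prod_nonneg fun k _ => hν0 _ _
    have hU'0 : ∀ i ω, 0 ≤ U' i ω := fun i ω => (readOnce_mem_unitInterval' (fun k => b k.succ) (fun k => hb0 _) (fun k => hb1 _) i ω).1
    have hU'1 : ∀ i ω, U' i ω ≤ 1 := fun i ω => (readOnce_mem_unitInterval' (fun k => b k.succ) (fun k => hb0 _) (fun k => hb1 _) i ω).2
    have hU'm : ∀ i, Monotone (U' i) := fun i => readOnce_monotone' (fun k => b k.succ) (fun k => hb1 _) (fun k => hbm _) i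
    have hν2 : SahiPositive (ν 0) 2 := SahiPositive.of_succ (hν0 0) (hν1 0) (hν3 0)
    have heb : 0 ≤ sahiE (ν 0) 3 (b 0) := hν3 0 (b 0) (hb0 0) (hbm 0)
    have step := SahiE3UnionTensor.sahiE_three_por_nonneg_of_sahiPositive_two W' (ν 0) hW'0 S1 (hν0 0) (hν1 0) PA hν2
      U' (b 0) hU'0 hU'1 hU'm (hb0 0) (hb1 0) (hbm 0) H heb
    have paV : SahiPositive (fun p : (Fin r → β) × β => W' p.1 * ν 0 p.2) 2 := sahiPositive_two_prodWeight W' (ν 0) hW'0 (hν0 0) PA hν2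
    let E : ((Fin r → β) × β) ≃ (Fin (r + 1) → β) :=
      ⟨fun p => Fin.cons p.2 p.1, fun ω => (Fin.tail ω, ω 0),
       fun p => by simp only [Fin.tail_cons, Fin.cons_zero],
       fun ω => by simp only [Fin.cons_self_tail]⟩
    have hEs : ∀ ω : Fin (r + 1) → β, E.symm ω = (Fin.tail ω, ω 0) := fun ω => rfl
    have hmono : ∀ x y : (Fin r → β) × β, x ≤ y → E.symm.symm x ≤ E.symm.symm y := by
      intro x y hxy
      show (Fin.cons x.2 x.1 : Fin (r + 1) → β) ≤ Fin.cons y.2 y.1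
      exact Fin.cons_le_cons.2 ⟨hxy.2, hxy.1⟩
    have hW : ((fun p : (Fin r → β) × β => W' p.1 * ν 0 p.2) ∘ E.symm) = fun ω : Fin (r + 1) → β => ∏ k, ν k (ω k) := by
      funext ω
      simp only [Function.comp, hEs, hW']
      rw [Fin.prod_univ_succ]
      simp only [Fin.tail]
      ring
    have hU : (fun i => (fun (i : Fin 3) (p : (Fin r → β) × β) => U' i p.1 + b 0 i p.2 - U' i p.1 * b 0 i p.2) i ∘ E.symm)
        = fun (i : Fin 3) (ω : Fin (r + 1) → β) => 1 - ∏ k, (1 - b k i (ω k)) := by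
      funext i ω
      simp only [Function.comp, hEs, hU']
      rw [Fin.prod_univ_succ]
      simp only [Fin.tail]
      ring
    refine ⟨?_, ?_, ?_⟩
    · have hVW : ∀ p : (Fin r → β) × β, W' p.1 * ν 0 p.2 = ∏ k, ν k ((E p) k) := by
        intro p
        have := congrArg (fun F => F (E p)) hW
        simp only [Function.comp, Equiv.symm_apply_apply] at this
        exact this
      rw [← Fintype.sum_equiv E _ _ hVW, Fintype.sum_prod_type]
      simp only [← Finset.mul_sum, hν1 0, mul_one]
      exact S1
    · have t := sahiPositive_two_comp_equiv E.symm hmono paV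
      rw [hW] at t; exact t
    · have t := sahiE_three_comp_equiv' E.symm (fun p : (Fin r → β) × β => W' p.1 * ν 0 p.2)
        (fun (i : Fin 3) (p : (Fin r → β) × β) => U' i p.1 + b 0 i p.2 - U' i p.1 * b 0 i p.2)
      rw [hW, hU] at t
      rw [t]; exact step

/-- **★ `E₃ ≥ 0` for read-once unions at order 3 — no missing-member condition.**  For `r` independent blocks on a finite preorder `β`
(probability weights `ν_k`, each Sahi-positive of order 3) with monotone `[0,1]`-valued members `b_k : Fin 3 → β → [0,1]`, the member-wise OR
`u_i(ω) = 1 − Π_k (1 − b_k i (ω_k))` has `E₃^{⊗ν}(u₀,u₁,u₂) ≥ 0`: Sahi's `C₃` for the class of read-once unions over independent `C₃` blocks.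
[this work] -/
theorem sahiE_three_readOnce_nonneg (r : ℕ) (ν : Fin r → β → ℝ) (hν0 : ∀ k t, 0 ≤ ν k t) (hν1 : ∀ k, ∑ t, ν k t = 1)
    (hν3 : ∀ k, SahiPositive (ν k) 3) (b : Fin r → Fin 3 → β → ℝ) (hb0 : ∀ k i t, 0 ≤ b k i t) (hb1 : ∀ k i t, b k i t ≤ 1)
    (hbm : ∀ k i, Monotone (b k i)) :
    0 ≤ sahiE (fun ω : Fin r → β => ∏ k, ν k (ω k)) 3 (fun (i : Fin 3) (ω : Fin r → β) => 1 - ∏ k, (1 - b k i (ω k))) :=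
  (sahiE_three_readOnce_aux r ν hν0 hν1 hν3 b hb0 hb1 hbm).2.2

/-- **Unconditional, order 3: FKG blocks on distributive lattices with at most four join-irreducibles** (e.g. `{0,1}⁴` with any
log-supermodular weight): `E₃ ≥ 0` for the read-once union of any number of independent such blocks with monotone `[0,1]`-valued members
(no missing-member condition). [this work] -/
theorem sahiE_three_readOnce_fkgFour_nonneg {α : Type*} [DistribLattice α] [Fintype α] [DecidableEq α]
    (h4 : Nat.card {j : α // SupIrred j} ≤ 4) (r : ℕ) (ν : Fin r → α → ℝ) (hν : ∀ k, IsFKGMeasure (ν k))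
    (b : Fin r → Fin 3 → α → ℝ) (hb0 : ∀ k i t, 0 ≤ b k i t) (hb1 : ∀ k i t, b k i t ≤ 1) (hbm : ∀ k i, Monotone (b k i)) :
    0 ≤ sahiE (fun ω : Fin r → α => ∏ k, ν k (ω k)) 3 (fun (i : Fin 3) (ω : Fin r → α) => 1 - ∏ k, (1 - b k i (ω k))) :=
  sahiE_three_readOnce_nonneg r ν (fun k t => (hν k).nonneg t) (fun k => (hν k).sum_eq_one)
    (fun k => SahiC3CubeFourFKG.sahiPositive_three_of_card_supIrred_le_four h4 (hν k)) b hb0 hb1 hbm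

/-- **Unconditional, order 3: blocks on products of two finite chains with product weights** (Lieb–Sahi Thm. 3.7): `E₃ ≥ 0` for the
read-once union of any number of independent such blocks with monotone `[0,1]`-valued members. [this work] (uses [LiebSahi2021, Thm. 3.7]) -/
theorem sahiE_three_readOnce_biChain_nonneg (p q r : ℕ) (w₁ : Fin r → Fin (p + 1) → ℝ) (w₂ : Fin r → Fin (q + 1) → ℝ)
    (h₁0 : ∀ k i, 0 ≤ w₁ k i) (h₁1 : ∀ k, ∑ i, w₁ k i = 1) (h₂0 : ∀ k j, 0 ≤ w₂ k j) (h₂1 : ∀ k, ∑ j, w₂ k j = 1)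
    (b : Fin r → Fin 3 → (Fin (p + 1) × Fin (q + 1)) → ℝ) (hb0 : ∀ k i t, 0 ≤ b k i t) (hb1 : ∀ k i t, b k i t ≤ 1)
    (hbm : ∀ k i, Monotone (b k i)) :
    0 ≤ sahiE (fun ω : Fin r → Fin (p + 1) × Fin (q + 1) => ∏ k, (w₁ k (ω k).1 * w₂ k (ω k).2)) 3
      (fun (i : Fin 3) (ω : Fin r → Fin (p + 1) × Fin (q + 1)) => 1 - ∏ k, (1 - b k i (ω k))) := by
  set ν : Fin r → (Fin (p + 1) × Fin (q + 1)) → ℝ := fun k t => w₁ k t.1 * w₂ k t.2 with hν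
  have hν0 : ∀ k t, 0 ≤ ν k t := fun k t => mul_nonneg (h₁0 k _) (h₂0 k _)
  have hν1 : ∀ k, ∑ t, ν k t = 1 := by
    intro k
    simp only [hν]
    rw [Fintype.sum_prod_type, ← Finset.sum_mul_sum, h₁1 k, h₂1 k, one_mul]
  have hν3 : ∀ k, SahiPositive (ν k) 3 := fun k =>
    ProductChains.sahiPositive_prodWeight (w₁ k) (w₂ k) (h₁0 k) (h₁1 k) (h₂0 k) (h₂1 k) 3
  have key := sahiE_three_readOnce_nonneg r ν hν0 hν1 hν3 b hb0 hb1 hbm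
  have hW : (fun ω : Fin r → Fin (p + 1) × Fin (q + 1) => ∏ k, (w₁ k (ω k).1 * w₂ k (ω k).2))
      = fun ω => ∏ k, ν k (ω k) := by funext ω; simp only [hν]
  rw [hW]
  exact key

end readOnce

end Summit.CriticalPhenomena.PercolationContinuityZ3.Theorems.SahiH4Plus

end
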